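import Mathlib
import Summits.AtomisticToContinuum.Crystallization.Theorems.GappedShellCensusFiveFoldRationingRStubFfrC5CorePentagon

/-!
# Crux `GappedShellCensus.FiveFoldRationingR` (stmt-AtomisticToContinuum-18071), line `Sketch` —
# stub `stub_ffrC5Core` (the finite core of the capped census),
# file 3/6: no two adjacent `5`-valent labels; the two poles (registered sub-goal `stub_ffrC5CorePoles`)

Setting (abstract fan data on the twelve labels `Fin 12`): a family `tri` of `3`-element label sets,
two per side, and a symmetric irreflexive Boolean bond relation with degrees in `{4, 5}`; every bond
is a side of exactly two members of `tri`, every bonded `3`-clique is in `tri`, every member of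
`tri` has a vertex bonded to the other two, every `5`-valent label has only bonded fan triangles and
every `4`-valent label at most two.

This file: (1) propagation — if `v` and its partner `u m` are both `5`-valent then `u (m + 1)` lies
in three bonded fan triangles, so it is `5`-valent; hence the set `D` of `5`-valent labels with a
`5`-valent partner is closed under partners; (2) double counting the fan triangles inside `D` (five
at each label, three labels each) and the handshake inside `D` give `6 ∣ #D`; `#D = 12` contradicts
the existence of a `4`-valent label and `#D = 6` forces a chord, so `D = ∅`: NO TWO `5`-VALENT
LABELS ARE ADJACENT; (3) a `4`-valent label has at most one `5`-valent partner (two would give four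
bonded fan triangles); (4) the closed neighbourhoods of the `5`-valent labels are pairwise disjoint
`6`-sets, so there are at most two, by the handshake parity exactly two, and they exhaust the twelve
labels.
-/

noncomputable section

namespace Summit.AtomisticToContinuum.Crystallization.Theorems

open Finset

section Poles

variable {bond : Fin 12 → Fin 12 → Bool} {tri : Finset (Finset (Fin 12))}
  (bond_symm : ∀ v w, bond v w = bond w v) (bond_irrefl : ∀ v, bond v v = false)
  (bond_deg : ∀ v, 4 ≤ (Finset.univ.filter fun w => bond v w = true).card ∧
    (Finset.univ.filter fun w => bond v w = true).card ≤ 5)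
  (tri_card : ∀ S ∈ tri, S.card = 3)
  (bond_side : ∀ v w, bond v w = true →
    (tri.filter fun S' => ({v, w} : Finset (Fin 12)) ⊆ S').card = 2)
  (bond_tri : ∀ a b c, a ≠ b → b ≠ c → a ≠ c → bond a b = true → bond b c = true →
    bond a c = true → ({a, b, c} : Finset (Fin 12)) ∈ tri)
  (five_T : ∀ v, (Finset.univ.filter fun w => bond v w = true).card = 5 →
    ∀ S ∈ tri, v ∈ S → ∀ a ∈ S, ∀ b ∈ S, a ≠ b → bond a b = true)
  (four_T : ∀ v, (Finset.univ.filter fun w => bond v w = true).card = 4 →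
    ((tri.filter fun S => v ∈ S).filter
      fun S => ∀ a ∈ S, ∀ b ∈ S, a ≠ b → bond a b = true).card ≤ 2)

include bond_irrefl bond_deg bond_side five_T four_T in
/-- **Propagation of valence five.** If `v` and its partner `u m` are both `5`-valent then so is
`u (m + 1)`: it lies in three bonded fan triangles, one too many for a `4`-valent label. [folklore] -/
theorem ffrCC_step5 {v : Fin 12} {u : Fin 5 → Fin 12}
    (hv : (Finset.univ.filter fun w => bond v w = true).card = 5) (hu : Function.Injective u)
    (hvu : ∀ i, bond v (u i) = true) (hT : ∀ i, ({v, u i, u (i + 1)} : Finset (Fin 12)) ∈ tri)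
    (m : Fin 5) (hm : (Finset.univ.filter fun w => bond (u m) w = true).card = 5) :
    (Finset.univ.filter fun w => bond (u (m + 1)) w = true).card = 5 := by
  by_contra h5
  have h4 : (Finset.univ.filter fun w => bond (u (m + 1)) w = true).card = 4 := by
    have := bond_deg (u (m + 1)); omega
  have hF := four_T (u (m + 1)) h4
  have memF : ∀ S, S ∈ tri → u (m + 1) ∈ S → (∀ a ∈ S, ∀ b ∈ S, a ≠ b → bond a b = true) →
      S ∈ (tri.filter fun S => u (m + 1) ∈ S).filter
        fun S => ∀ a ∈ S, ∀ b ∈ S, a ≠ b → bond a b = true := by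
    intro S hS hmS hb
    simp only [Finset.mem_filter]
    exact ⟨⟨hS, hmS⟩, hb⟩
  have memP : ∀ S, S ∈ tri.filter (fun S' => ({u m, u (m + 1)} : Finset (Fin 12)) ⊆ S') ↔
      S ∈ tri ∧ u m ∈ S ∧ u (m + 1) ∈ S := by
    intro S
    simp only [Finset.mem_filter, Finset.insert_subset_iff, Finset.singleton_subset_iff]
  obtain ⟨R, hR, hRT⟩ := ffrCC_other_of_card_two (bond_side _ _ (ffrCC_uu five_T hv hu hT m).1)
    ((memP _).2 ⟨hT m, by simp, by simp⟩)
  obtain ⟨hRtri, hmR, hm1R⟩ := (memP R).1 hR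
  have hTb : ∀ i, ∀ a ∈ ({v, u i, u (i + 1)} : Finset (Fin 12)), ∀ b ∈ ({v, u i, u (i + 1)} :
      Finset (Fin 12)), a ≠ b → bond a b = true := fun i => five_T v hv _ (hT i) (by simp)
  have hne1 : ({v, u m, u (m + 1)} : Finset (Fin 12)) ≠ {v, u (m + 1), u (m + 1 + 1)} := by
    intro e
    have := ffrCC_T_inj bond_irrefl hu hvu e
    omega
  have hne2 : R ≠ {v, u (m + 1), u (m + 1 + 1)} := by
    intro e
    have : u m ∈ ({v, u (m + 1), u (m + 1 + 1)} : Finset (Fin 12)) := by rw [← e]; exact hmR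
    have := ffrCC_mem_T bond_irrefl hu hvu this
    omega
  have hm1T : u (m + 1) ∈ ({v, u (m + 1), u (m + 1 + 1)} : Finset (Fin 12)) := by simp
  exact ffrCC_absurd_of_card_le_two hF (memF _ (hT m) (by simp) (hTb m))
    (memF _ (hT (m + 1)) hm1T (hTb (m + 1))) (memF R hRtri hm1R (five_T (u m) hm R hRtri hmR))
    hne1 (Ne.symm hRT) hne2.symm

include bond_irrefl bond_deg tri_card bond_side five_T four_T in
/-- **Closure.** A `5`-valent label with one `5`-valent partner has only `5`-valent partners.
[folklore] -/
theorem ffrCC_closure5 {v : Fin 12} (hv : (Finset.univ.filter fun w => bond v w = true).card = 5)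
    (h : ∃ a, bond v a = true ∧ (Finset.univ.filter fun w => bond a w = true).card = 5)
    (b : Fin 12) (hb : bond v b = true) :
    (Finset.univ.filter fun w => bond b w = true).card = 5 := by
  obtain ⟨u, hu, hvu, hcov, hT, -⟩ := ffrCC_pentagon bond_irrefl tri_card bond_side five_T v hv
  obtain ⟨a, ha, ha5⟩ := h
  obtain ⟨j, rfl⟩ := hcov a ha
  obtain ⟨i, rfl⟩ := hcov b hb
  have step := ffrCC_step5 bond_irrefl bond_deg bond_side five_T four_T hv hu hvu hT
  have h1 := step j ha5
  have h2 := step _ h1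
  have h3 := step _ h2
  have h4 := step _ h3
  have : i = j ∨ i = j + 1 ∨ i = j + 1 + 1 ∨ i = j + 1 + 1 + 1 ∨ i = j + 1 + 1 + 1 + 1 := by omega
  rcases this with e | e | e | e | e <;> rw [e]
  exacts [ha5, h1, h2, h3, h4]

include bond_symm bond_irrefl bond_deg tri_card bond_side bond_tri five_T four_T in
/-- **No two adjacent `5`-valent labels.**  The set `D` of `5`-valent labels with a `5`-valent
partner is closed under partners; counting the fan triangles inside `D` (five at each label of
`D`, three labels each) and the bonds inside `D` (handshake) gives `6 ∣ #D`; `#D = 12` contradicts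
the existence of a `4`-valent label and `#D = 6` forces a chord in a link pentagon. [folklore] -/
theorem ffrCC_no55 (h4ex : ∃ v, (Finset.univ.filter fun w => bond v w = true).card = 4)
    (v a : Fin 12) (hv : (Finset.univ.filter fun w => bond v w = true).card = 5)
    (ha : bond v a = true) : (Finset.univ.filter fun w => bond a w = true).card = 4 := by
  have hdeg := bond_deg a
  by_contra h4
  have ha5 : (Finset.univ.filter fun w => bond a w = true).card = 5 := by omega
  -- the set `D`
  set D : Finset (Fin 12) := Finset.univ.filter fun x =>
    (Finset.univ.filter fun w => bond x w = true).card = 5 ∧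
      ∃ y, bond x y = true ∧ (Finset.univ.filter fun w => bond y w = true).card = 5 with hD
  have memD : ∀ x, x ∈ D ↔ (Finset.univ.filter fun w => bond x w = true).card = 5 ∧
      ∃ y, bond x y = true ∧ (Finset.univ.filter fun w => bond y w = true).card = 5 := by
    intro x; simp [hD]
  have hvD : v ∈ D := (memD v).2 ⟨hv, a, ha, ha5⟩
  -- closure under partners
  have hcl : ∀ x ∈ D, ∀ b, bond x b = true → b ∈ D := by
    intro x hx b hb
    obtain ⟨hx5, hx⟩ := (memD x).1 hx
    refine (memD b).2 ⟨ffrCC_closure5 bond_irrefl bond_deg tri_card bond_side five_T four_T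
      hx5 hx b hb, x, ?_, hx5⟩
    rw [bond_symm]; exact hb
  -- the fan triangles inside `D`
  set TD : Finset (Finset (Fin 12)) := tri.filter fun S => S ⊆ D with hTD
  have hfib : ∀ x ∈ D, (TD.filter fun S => x ∈ S).card = 5 := by
    intro x hx
    obtain ⟨hx5, -⟩ := (memD x).1 hx
    obtain ⟨u, hu, hxu, -, hT, hclT⟩ := ffrCC_pentagon bond_irrefl tri_card bond_side five_T x hx5
    have heq : (TD.filter fun S => x ∈ S) =
        Finset.univ.image fun i => ({x, u i, u (i + 1)} : Finset (Fin 12)) := by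
      ext S
      simp only [hTD, Finset.mem_filter, Finset.mem_image, Finset.mem_univ, true_and]
      constructor
      · rintro ⟨⟨hS, -⟩, hxS⟩
        obtain ⟨i, hi⟩ := hclT S hS hxS
        exact ⟨i, hi.symm⟩
      · rintro ⟨i, rfl⟩
        refine ⟨⟨hT i, ?_⟩, by simp⟩
        intro z hz
        simp only [Finset.mem_insert, Finset.mem_singleton] at hz
        rcases hz with rfl | rfl | rfl
        exacts [hx, hcl x hx _ (hxu i), hcl x hx _ (hxu (i + 1))]
    rw [heq, Finset.card_image_of_injective _ fun i j e => ffrCC_T_inj bond_irrefl hu hxu e]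
    simp
  have hsum := Finset.sum_card_inter hfib
  have hsum3 : ∑ S ∈ TD, (D ∩ S).card = ∑ S ∈ TD, 3 := by
    refine Finset.sum_congr rfl fun S hS => ?_
    have hS := Finset.mem_filter.1 hS
    rw [Finset.inter_eq_right.2 hS.2, tri_card S hS.1]
  rw [hsum3, Finset.sum_const, smul_eq_mul] at hsum
  -- handshake inside `D`
  have hpar := ffrCC_even_pairs bond bond_symm bond_irrefl D
  have hsum5 : ∑ x ∈ D, (D.filter fun b => bond x b = true).card = ∑ x ∈ D, 5 := by
    refine Finset.sum_congr rfl fun x hx => ?_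
    obtain ⟨hx5, -⟩ := (memD x).1 hx
    rw [← hx5]
    congr 1
    ext b
    simp only [Finset.mem_filter, Finset.mem_univ, true_and, and_iff_right_iff_imp]
    exact hcl x hx b
  rw [hsum5, Finset.sum_const, smul_eq_mul] at hpar
  have hle : D.card ≤ 12 := (Finset.card_le_univ D).trans (by simp)
  have hcases : D.card = 6 ∨ D.card = 12 := by
    have hpos : 0 < D.card := Finset.card_pos.2 ⟨v, hvD⟩
    rcases hpar with ⟨r, hr⟩
    omega
  rcases hcases with h6 | h12
  · -- `#D = 6`: `D` is `v` with its five partners, and `u 0 ~ u 2` is a chord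
    obtain ⟨u, hu, hvu, -, -, hclT⟩ := ffrCC_pentagon bond_irrefl tri_card bond_side five_T v hv
    have hu0D : u 0 ∈ D := hcl v hvD _ (hvu 0)
    have hu2D : u 2 ∈ D := hcl v hvD _ (hvu 2)
    obtain ⟨hu05, -⟩ := (memD (u 0)).1 hu0D
    have hsub : (Finset.univ.filter fun w => bond (u 0) w = true) ⊆ D.erase (u 0) := by
      intro b hb
      simp only [Finset.mem_filter, Finset.mem_univ, true_and] at hb
      exact Finset.mem_erase.2 ⟨ffrCC_ne_of_bond bond_irrefl hb, hcl _ hu0D b hb⟩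
    have heq := Finset.eq_of_subset_of_card_le hsub
      (by rw [Finset.card_erase_of_mem hu0D, h6, hu05])
    have h02 : u 2 ∈ Finset.univ.filter fun w => bond (u 0) w = true := by
      rw [heq]
      exact Finset.mem_erase.2 ⟨fun e => by have := hu e; omega, hu2D⟩
    simp only [Finset.mem_filter, Finset.mem_univ, true_and] at h02
    have := ffrCC_chord bond_irrefl bond_tri hu hvu hclT h02
    omega
  · -- `#D = 12`: every label is `5`-valent
    obtain ⟨x, hx⟩ := h4ex
    have hxD : x ∈ D := by
      rw [Finset.eq_univ_of_card D (by simpa using h12)]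
      exact Finset.mem_univ x
    have := ((memD x).1 hxD).1
    omega

include bond_irrefl tri_card bond_side five_T four_T in
/-- **A `4`-valent label has at most one `5`-valent partner** (given that `5`-valent labels are
pairwise non-adjacent): two would put it into four bonded fan triangles. [folklore] -/
theorem ffrCC_one5
    (hD : ∀ v a, (Finset.univ.filter fun w => bond v w = true).card = 5 → bond v a = true →
      (Finset.univ.filter fun w => bond a w = true).card = 4)
    (a w₁ w₂ : Fin 12) (h₁ : (Finset.univ.filter fun w => bond w₁ w = true).card = 5)
    (h₂ : (Finset.univ.filter fun w => bond w₂ w = true).card = 5)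
    (ha₁ : bond w₁ a = true) (ha₂ : bond w₂ a = true) : w₁ = w₂ := by
  by_contra hne
  have h4 := hD w₁ a h₁ ha₁
  obtain ⟨u, hu, hvu, hcov, hT, -⟩ := ffrCC_pentagon bond_irrefl tri_card bond_side five_T w₁ h₁
  obtain ⟨u', hu', hvu', hcov', hT', -⟩ := ffrCC_pentagon bond_irrefl tri_card bond_side five_T w₂ h₂
  obtain ⟨i, rfl⟩ := hcov a ha₁
  obtain ⟨j, hj⟩ := hcov' (u i) ha₂
  have memF : ∀ S, S ∈ tri → u i ∈ S → (∀ a ∈ S, ∀ b ∈ S, a ≠ b → bond a b = true) →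
      S ∈ (tri.filter fun S => u i ∈ S).filter
        fun S => ∀ a ∈ S, ∀ b ∈ S, a ≠ b → bond a b = true := by
    intro S hS hmS hb
    simp only [Finset.mem_filter]
    exact ⟨⟨hS, hmS⟩, hb⟩
  have e : i - 1 + 1 = i := by omega
  have hTm : ({w₁, u (i - 1), u i} : Finset (Fin 12)) ∈ tri := by
    have := hT (i - 1)
    rwa [e] at this
  have hw₂T : ∀ k, w₂ ∉ ({w₁, u k, u (k + 1)} : Finset (Fin 12)) := by
    intro k hk
    simp only [Finset.mem_insert, Finset.mem_singleton] at hk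
    rcases hk with h | h | h
    · exact hne (h.symm)
    · have := hD w₁ (u k) h₁ (hvu k)
      rw [← h] at this
      omega
    · have := hD w₁ (u (k + 1)) h₁ (hvu (k + 1))
      rw [← h] at this
      omega
  have hne1 : ({w₁, u (i - 1), u i} : Finset (Fin 12)) ≠ {w₁, u i, u (i + 1)} := by
    intro he
    have he' : ({w₁, u (i - 1), u (i - 1 + 1)} : Finset (Fin 12)) = {w₁, u i, u (i + 1)} := by
      rw [e]; exact he
    have := ffrCC_T_inj bond_irrefl hu hvu he'
    omega
  have hne2 : ({w₂, u' j, u' (j + 1)} : Finset (Fin 12)) ≠ {w₁, u i, u (i + 1)} := by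
    intro he
    exact hw₂T i (by rw [← he]; simp)
  have hne3 : ({w₂, u' j, u' (j + 1)} : Finset (Fin 12)) ≠ {w₁, u (i - 1), u i} := by
    intro he
    have := hw₂T (i - 1)
    rw [e] at this
    exact this (by rw [← he]; simp)
  exact ffrCC_absurd_of_card_le_two (four_T (u i) h4)
    (memF _ hTm (by simp) (by have := five_T w₁ h₁ _ (hT (i - 1)) (by simp); rwa [e] at this))
    (memF _ (hT i) (by simp) (five_T w₁ h₁ _ (hT i) (by simp)))
    (memF _ (hT' j) (by rw [hj]; simp) (five_T w₂ h₂ _ (hT' j) (by simp)))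
    hne1 hne3.symm hne2.symm

include bond_symm bond_irrefl bond_deg tri_card bond_side five_T four_T in
/-- **The two poles.**  With no two adjacent `5`-valent labels, the closed neighbourhoods of the
`5`-valent labels are pairwise disjoint `6`-sets, so there are at most two of them; by the
handshake parity their number is even, hence exactly two, and the two closed neighbourhoods
exhaust the twelve labels. [folklore] -/
theorem ffrCC_poles
    (hD : ∀ v a, (Finset.univ.filter fun w => bond v w = true).card = 5 → bond v a = true →
      (Finset.univ.filter fun w => bond a w = true).card = 4)
    (h5ex : ∃ v, (Finset.univ.filter fun w => bond v w = true).card = 5) :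
    ∃ w w' : Fin 12, w ≠ w' ∧ (Finset.univ.filter fun z => bond w z = true).card = 5 ∧
      (Finset.univ.filter fun z => bond w' z = true).card = 5 ∧
      ∀ z, z = w ∨ z = w' ∨ bond w z = true ∨ bond w' z = true := by
  set F : Finset (Fin 12) := Finset.univ.filter fun v =>
    (Finset.univ.filter fun w => bond v w = true).card = 5 with hF
  have memF : ∀ v, v ∈ F ↔ (Finset.univ.filter fun w => bond v w = true).card = 5 := by
    intro v; simp [hF]
  -- closed neighbourhoods
  set C : Fin 12 → Finset (Fin 12) := fun v => insert v (Finset.univ.filter fun w => bond v w = true)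
    with hC
  have memC : ∀ v z, z ∈ C v ↔ z = v ∨ bond v z = true := by
    intro v z; simp [hC]
  have cardC : ∀ v ∈ F, (C v).card = 6 := by
    intro v hv
    rw [hC, Finset.card_insert_of_notMem, (memF v).1 hv]
    simp [bond_irrefl]
  have hdisj : (F : Set (Fin 12)).PairwiseDisjoint C := by
    intro w hw w' hw' hne
    rw [Finset.mem_coe, memF] at hw hw'
    refine Finset.disjoint_left.2 fun z hz hz' => ?_
    rw [memC] at hz hz'
    rcases hz with rfl | hz <;> rcases hz' with h | h
    · exact hne h
    · have := hD w' _ hw' h; omega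
    · rw [h] at hz; have := hD w _ hw hz; omega
    · exact hne (ffrCC_one5 bond_irrefl tri_card bond_side five_T four_T hD z w w' hw hw' hz h)
  have hU := Finset.card_biUnion hdisj
  rw [Finset.sum_congr rfl cardC, Finset.sum_const, smul_eq_mul] at hU
  have hle : (F.biUnion C).card ≤ 12 := (Finset.card_le_univ _).trans (by simp)
  -- parity of the number of `5`-valent labels
  have hpar := ffrCC_even_pairs bond bond_symm bond_irrefl Finset.univ
  have hsum : ∑ v ∈ (Finset.univ : Finset (Fin 12)),
      ((Finset.univ : Finset (Fin 12)).filter fun b => bond v b = true).card =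
        ∑ v ∈ (Finset.univ : Finset (Fin 12)), (4 + if v ∈ F then 1 else 0) := by
    refine Finset.sum_congr rfl fun v _ => ?_
    by_cases h : v ∈ F
    · rw [if_pos h, (memF v).1 h]
    · rw [if_neg h]
      rw [memF] at h
      have := bond_deg v
      omega
  rw [hsum, Finset.sum_add_distrib, Finset.sum_const, smul_eq_mul, Finset.sum_boole] at hpar
  simp only [Finset.card_univ, Fintype.card_fin, Nat.cast_id] at hpar
  have hFF : (Finset.univ.filter fun v => v ∈ F) = F := by ext v; simp
  rw [hFF] at hpar
  have hpos : 0 < F.card := by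
    obtain ⟨v, hv⟩ := h5ex
    exact Finset.card_pos.2 ⟨v, (memF v).2 hv⟩
  have h2 : F.card = 2 := by
    rcases hpar with ⟨r, hr⟩
    omega
  obtain ⟨w, w', hne, hFeq⟩ := Finset.card_eq_two.1 h2
  have hw : w ∈ F := by rw [hFeq]; simp
  have hw' : w' ∈ F := by rw [hFeq]; simp
  refine ⟨w, w', hne, (memF w).1 hw, (memF w').1 hw', fun z => ?_⟩
  have huniv : F.biUnion C = Finset.univ := Finset.eq_univ_of_card _ (by simp; omega)
  have hz : z ∈ F.biUnion C := huniv ▸ Finset.mem_univ z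
  rw [Finset.mem_biUnion] at hz
  obtain ⟨v, hv, hzv⟩ := hz
  rw [hFeq] at hv
  rw [memC] at hzv
  simp only [Finset.mem_insert, Finset.mem_singleton] at hv
  rcases hv with rfl | rfl <;> rcases hzv with h | h
  · exact Or.inl h
  · exact Or.inr (Or.inr (Or.inl h))
  · exact Or.inr (Or.inl h)
  · exact Or.inr (Or.inr (Or.inr h))

end Poles

/-- **Registered sub-goal `stub_ffrC5CorePoles` (no two adjacent `5`-valent labels; the two poles
and their partners exhaust the twelve labels).** [folklore] -/
theorem stub_ffrC5CorePoles (bond : Fin 12 → Fin 12 → Bool) (tri : Finset (Finset (Fin 12)))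
    (bond_symm : ∀ v w, bond v w = bond w v) (bond_irrefl : ∀ v, bond v v = false)
    (bond_deg : ∀ v, 4 ≤ (Finset.univ.filter fun w => bond v w = true).card ∧
      (Finset.univ.filter fun w => bond v w = true).card ≤ 5)
    (h4ex : ∃ v, (Finset.univ.filter fun w => bond v w = true).card = 4)
    (h5ex : ∃ v, (Finset.univ.filter fun w => bond v w = true).card = 5)
    (tri_card : ∀ S ∈ tri, S.card = 3)
    (bond_side : ∀ v w, bond v w = true →
      (tri.filter fun S' => ({v, w} : Finset (Fin 12)) ⊆ S').card = 2)
    (bond_tri : ∀ a b c, a ≠ b → b ≠ c → a ≠ c → bond a b = true → bond b c = true →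
      bond a c = true → ({a, b, c} : Finset (Fin 12)) ∈ tri)
    (five_T : ∀ v, (Finset.univ.filter fun w => bond v w = true).card = 5 →
      ∀ S ∈ tri, v ∈ S → ∀ a ∈ S, ∀ b ∈ S, a ≠ b → bond a b = true)
    (four_T : ∀ v, (Finset.univ.filter fun w => bond v w = true).card = 4 →
      ((tri.filter fun S => v ∈ S).filter
        fun S => ∀ a ∈ S, ∀ b ∈ S, a ≠ b → bond a b = true).card ≤ 2) :
    (∀ v a, (Finset.univ.filter fun w => bond v w = true).card = 5 → bond v a = true →
      (Finset.univ.filter fun w => bond a w = true).card = 4) ∧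
    ∃ w w' : Fin 12, w ≠ w' ∧ (Finset.univ.filter fun z => bond w z = true).card = 5 ∧
      (Finset.univ.filter fun z => bond w' z = true).card = 5 ∧
      ∀ z, z = w ∨ z = w' ∨ bond w z = true ∨ bond w' z = true :=
  have hD := ffrCC_no55 bond_symm bond_irrefl bond_deg tri_card bond_side bond_tri five_T four_T h4ex
  ⟨hD, ffrCC_poles bond_symm bond_irrefl bond_deg tri_card bond_side five_T four_T hD h5ex⟩

end Summit.AtomisticToContinuum.Crystallization.Theorems

end
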